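import Literature.Barriers.RiemannHypothesis.EpsteinZetaCentralZero
import Literature.Analysis.SpecialFunctions.EulerMascheroniBounds
import HarnessLib

/-!
# Bétermin–Šamaj–Travěnec (2021), Conjecture 1.1: `Δ_c^* = e^γ/(4π)` — refuted

L. Bétermin, L. Šamaj, I. Travěnec, *Interplay between critical and off-critical zeros of
two-dimensional Epstein zeta functions*, arXiv:2110.09368 (v2, 16 Nov 2022)
[BeterminSamajTravenec2021], §1.1: for the rectangular lattice `ℤ ⊕ Δℤ`, `Δ > 0`,

  (1.1) `ζ^{(2)}(s, Δ) := ½ Σ'_{(j,k) ∈ ℤ²} (j² + Δ²k²)^{−s}`, `Re(s) > 1`,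

"the Epstein zeta function can be analytically continued to the whole complex `s`-plane" (off the
simple pole at `s = 1`); §1.2, item 4: "A pair of real off-critical zeros is numerically found for
each `Δ ∈ (0, Δ_c^*] ∪ [1/Δ_c^*, ∞)` with `Δ_c^* ≈ 0.141733`" (§4.2), and then, verbatim:

> **Conjecture 1.1.** The unique solution of `ζ^{(2)}(1/2, Δ) = 0` for `Δ ∈ (0, 1)` is
> `Δ = Δ_c^* = e^γ/(4π)` where `γ` is the Euler-Mascheroni constant.

**The conjecture is false: `ζ^{(2)}(½, e^γ/(4π)) > 0`** (`statement11_false`,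
`re_half_deltaStar_pos`). By the Chowla–Selberg formula at the central point (Bateman–Grosswald
1964, Theorem 1 (3)–(4) at `s = ½`; in the tree `re_Λ_half_eq_of_re_zero` and
`continuation_ofReal_eq` of `Literature.Barriers.RiemannHypothesis`, via the theta-function
continuation `Λ_z` of Montgomery–Vaughan §10.1 Ex. 25), for every `Δ > 0` the value at `s = ½` of
the analytic continuation of (1.1) is REAL and equals (`re_half_eq`)

  `ζ^{(2)}(½, Δ) = (γ − log Δ − log 4π)/Δ + (2/Δ) · Σ_{m,k ≥ 1} I(πmk/Δ)`,
  `I(κ) = ∫₀^∞ t⁻¹ e^{−κ(t + 1/t)} dt` (`= 2K₀(2κ) > 0`).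

At `Δ = e^γ/(4π)` the first term vanishes EXACTLY (this is where the conjectured closed form comes
from) while the Bessel series is strictly positive: `ζ^{(2)}(½, e^γ/(4π)) = 8πe^{−γ} Σ_{m,k≥1}
I(4π²e^{−γ}mk) > 0` (about `3·10⁻¹⁹`, below the resolution of the paper's numerics). The edge zero
itself exists: `Δ ↦ ζ^{(2)}(½, Δ)` is continuous, NEGATIVE at `Δ = 1/7.0554` (Bateman–Grosswald
(11), the tree's `re_Λ_half_neg`) and positive at `e^γ/(4π) < 1/7.0554`, so `ζ^{(2)}(½, Δ_c) = 0`
for some `Δ_c ∈ (e^γ/(4π), 1/7.0554)` (`exists_true_zero`): the true value lies strictly to the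
RIGHT of the conjectured one, within `2.2·10⁻⁶` (60-digit numerics, not certified here, give
`Δ_c − e^γ/(4π) ≈ 5.9·10⁻²¹`). The conjectured constant is Bateman–Grosswald's threshold
`k = 4πe^{−γ} = 7.05551…` read as `Δ = 1/k`, inside their window `(7.0554, 7.0556)` between (11)
`Z(½) < 0` and (10) `Z(½) > 0` (`deltaStar_window`). Everything below is PROVED (standard axioms;
the only numerics: the tree's decimal bounds on `γ`, `log 4π − log 7.0554`, `log 4π − log 7.0556`):
`latticeSum` — (1.1) (`hasSum_latticeSum`); `IsZetaTwo Δ F` — `F` is the analytic continuation of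
`ζ^{(2)}(·, Δ)` to `ℂ ∖ {1}` (exists, unique: `exists_isZetaTwo`, `IsZetaTwo.eqOn`);
`VanishesAtHalf Δ` — "`ζ^{(2)}(1/2, Δ) = 0`"; `deltaStar = e^γ/(4π)`; `solutionSet` — the
`Δ ∈ (0,1)` with `ζ^{(2)}(½, Δ) = 0`, the printed statement being `solutionSet = {e^γ/(4π)}`;
`re_half_eq`; **`statement11_false : solutionSet ≠ {deltaStar}`**; `exists_true_zero`.

AI-produced formalisation for the refutations bundle `papers/_cross/refutations`, item (viii); AI
review is weaker than expert review.

## References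

* L. Bétermin, L. Šamaj, I. Travěnec, arXiv:2110.09368v2, §1.1 (1.1), §1.2 item 4, Conjecture 1.1,
  §4.2. [BeterminSamajTravenec2021]
* P. T. Bateman, E. Grosswald, *On Epstein's zeta function*, Acta Arith. 9 (1964) 365–373, Theorem 1
  (3)–(4), Theorem 3 (9)–(11) [BatemanGrosswald1964]; H. L. Montgomery, R. C. Vaughan,
  *Multiplicative Number Theory I*, §10.1 Exercise 25 [MontgomeryVaughan2007].
-/

noncomputable section

open Complex Filter Topology MeasureTheory Set
open scoped UpperHalfPlane

namespace Literature.NumberTheory.LFunctions.BeterminSamajTravenec2021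

open Literature.Barriers.RiemannHypothesis Literature.NumberTheory.Automorphic
open Literature.Analysis.SpecialFunctions

/-- The two-dimensional Epstein zeta function of the rectangular lattice `ℤ ⊕ Δℤ` in its half-plane
of absolute convergence, (1.1): `ζ^{(2)}(s, Δ) = ½ Σ'_{(j,k) ∈ ℤ²} (j² + Δ²k²)^{−s}`, `Re(s) > 1` —
half the tree's Epstein zeta function `epsteinZeta 1 0 (Δ²)` of the binary form `x² + Δ²y²`
(`hasSum_latticeSum`). [cite: BeterminSamajTravenec2021, §1.1 (1.1)] -/
def latticeSum (Δ : ℝ) (s : ℂ) : ℂ := 1 / 2 * epsteinZeta 1 0 (Δ ^ 2) s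

/-- `x² + Δ²y²` is a positive definite binary form (`a = 1 > 0`, `d = −4Δ² < 0`). [folklore] -/
theorem posDef {Δ : ℝ} (hΔ : 0 < Δ) : IsPosDefForm 1 0 (Δ ^ 2) :=
  ⟨one_pos, by nlinarith [pow_pos hΔ 2]⟩

/-- (1.1) literally: for `Re(s) > 1`, `latticeSum Δ s` is the sum of the absolutely convergent
double series `½ · 1/(j² + Δ²k²)^s` over `(j, k) ∈ ℤ² ∖ {(0,0)}`.
[cite: BeterminSamajTravenec2021, §1.1 (1.1)] -/
theorem hasSum_latticeSum {Δ : ℝ} (hΔ : 0 < Δ) {s : ℂ} (hs : 1 < s.re) :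
    HasSum (fun p : ℤ × ℤ => if p = 0 then (0 : ℂ) else
      1 / 2 * ((((p.1 : ℝ) ^ 2 + Δ ^ 2 * (p.2 : ℝ) ^ 2 : ℝ) : ℂ) ^ s)⁻¹) (latticeSum Δ s) := by
  have hfun : (fun p : ℤ × ℤ => if p = 0 then (0 : ℂ) else
      1 / 2 * ((((p.1 : ℝ) ^ 2 + Δ ^ 2 * (p.2 : ℝ) ^ 2 : ℝ) : ℂ) ^ s)⁻¹) =
      fun p => 1 / 2 * epsteinTerm 1 0 (Δ ^ 2) s p := by
    funext p
    have e : bqfEval 1 0 (Δ ^ 2) p = (p.1 : ℝ) ^ 2 + Δ ^ 2 * (p.2 : ℝ) ^ 2 := by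
      unfold bqfEval; ring
    simp only [epsteinTerm]
    split_ifs with hp
    · simp
    · rw [e, Complex.cpow_neg]
  rw [hfun]
  exact (hasSum_epsteinZeta (posDef hΔ) hs).mul_left (1 / 2 : ℂ)

/-- `F` is the function `s ↦ ζ^{(2)}(s, Δ)` of the paper on the whole plane: "the Epstein zeta
function can be analytically continued to the whole complex `s`-plane" (off the simple pole at
`s = 1`) — `F` is complex-differentiable on `ℂ ∖ {1}` and equals (1.1) for `Re(s) > 1`. Such an `F`
exists and is unique (`exists_isZetaTwo`, `IsZetaTwo.eqOn`).
[cite: BeterminSamajTravenec2021, §1.1 (after (1.3))] -/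
def IsZetaTwo (Δ : ℝ) (F : ℂ → ℂ) : Prop :=
  DifferentiableOn ℂ F {s : ℂ | s ≠ 1} ∧ ∀ s : ℂ, 1 < s.re → F s = latticeSum Δ s

/-- `F` continues `ζ^{(2)}(·, Δ)` iff `2F` continues the tree's `ζ_Q`, `Q = x² + Δ²y²`.
[folklore] -/
theorem isZetaTwo_iff (Δ : ℝ) (F : ℂ → ℂ) :
    IsZetaTwo Δ F ↔ IsEpsteinContinuation 1 0 (Δ ^ 2) (fun s => 2 * F s) := by
  constructor
  · rintro ⟨hd, hs⟩
    refine ⟨hd.const_mul 2, fun s h => ?_⟩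
    show 2 * F s = _
    rw [hs s h, latticeSum]
    ring
  · rintro ⟨hd, hs⟩
    refine ⟨(hd.const_mul (1 / 2 : ℂ)).congr fun s _ => ?_, fun s h => ?_⟩
    · show F s = 1 / 2 * (2 * F s)
      ring
    · have e : 2 * F s = epsteinZeta 1 0 (Δ ^ 2) s := hs s h
      rw [latticeSum, ← e]
      ring

/-- Uniqueness of the continuation (identity theorem). [folklore] -/
theorem IsZetaTwo.eqOn {Δ : ℝ} {F G : ℂ → ℂ} (hF : IsZetaTwo Δ F) (hG : IsZetaTwo Δ G) :
    EqOn F G {s : ℂ | s ≠ 1} := fun s hs => by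
  have h := ((isZetaTwo_iff Δ F).1 hF).eqOn ((isZetaTwo_iff Δ G).1 hG) hs
  dsimp only at h
  exact mul_left_cancel₀ two_ne_zero h

/-- Existence of the continuation (Riemann's theta-function method, the tree's
`exists_continuation_eq_Λ`). [folklore] -/
theorem exists_isZetaTwo {Δ : ℝ} (hΔ : 0 < Δ) : ∃ F : ℂ → ℂ, IsZetaTwo Δ F := by
  obtain ⟨z, hre, him⟩ := exists_zQ (posDef hΔ)
  obtain ⟨W, hW, -⟩ := exists_continuation_eq_Λ (posDef hΔ) z hre him
  refine ⟨fun s => 1 / 2 * W s, (isZetaTwo_iff Δ _).2 ?_⟩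
  have e : (fun s => 2 * (1 / 2 * W s)) = W := by funext s; ring
  rw [e]
  exact hW

/-- "`ζ^{(2)}(1/2, Δ) = 0`": the continued function vanishes at the central point `s = ½`
(for `Δ > 0` equivalently: SOME continuation vanishes there, `vanishesAtHalf_iff_exists`).
[cite: BeterminSamajTravenec2021, Conj. 1.1] -/
def VanishesAtHalf (Δ : ℝ) : Prop := ∀ F : ℂ → ℂ, IsZetaTwo Δ F → F (1 / 2) = 0

/-- The `∀`- and `∃`-readings of "`ζ^{(2)}(1/2, Δ) = 0`" agree (`Δ > 0`). [folklore] -/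
theorem vanishesAtHalf_iff_exists {Δ : ℝ} (hΔ : 0 < Δ) :
    VanishesAtHalf Δ ↔ ∃ F : ℂ → ℂ, IsZetaTwo Δ F ∧ F (1 / 2) = 0 := by
  constructor
  · intro h
    obtain ⟨F, hF⟩ := exists_isZetaTwo hΔ
    exact ⟨F, hF, h F hF⟩
  · rintro ⟨F, hF, h0⟩ G hG
    rw [← h0]
    exact (hG.eqOn hF) (show (1 / 2 : ℂ) ∈ {s : ℂ | s ≠ 1} by norm_num)

/-- The proposed critical anisotropy `Δ_c^* = e^γ/(4π)` (`= 0.1417332…`).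
[cite: BeterminSamajTravenec2021, Conj. 1.1] -/
def deltaStar : ℝ := Real.exp Real.eulerMascheroniConstant / (4 * Real.pi)

/-- The solution set of "`ζ^{(2)}(1/2, Δ) = 0` for `Δ ∈ (0, 1)`": the `Δ ∈ (0, 1)` at which (the
analytic continuation of) `ζ^{(2)}(·, Δ)` vanishes at `s = ½`. The printed claim (labelled Conj. 1.1
there) reads, verbatim: "The unique solution of `ζ^{(2)}(1/2, Δ) = 0` for `Δ ∈ (0, 1)` is
`Δ = Δ_c^* = e^γ/(4π)` where `γ` is the Euler-Mascheroni constant", i.e.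
`solutionSet = {deltaStar}` — **REFUTED below** (`statement11_false`).
[cite: BeterminSamajTravenec2021, Conj. 1.1] -/
def solutionSet : Set ℝ := {Δ : ℝ | Δ ∈ Ioo (0 : ℝ) 1 ∧ VanishesAtHalf Δ}

/-- The point `z_Q = (b + i√D)/(2c) = i/Δ ∈ ℍ` attached to `Q = x² + Δ²y²`. [folklore] -/
theorem exists_z {Δ : ℝ} (hΔ : 0 < Δ) : ∃ z : ℍ, z.re = 0 / (2 * Δ ^ 2) ∧
    z.im = Real.sqrt (4 * 1 * Δ ^ 2 - 0 ^ 2) / (2 * Δ ^ 2) ∧ z.re = 0 ∧ z.im = 1 / Δ := by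
  obtain ⟨z, hre, him⟩ := exists_zQ (posDef hΔ)
  refine ⟨z, hre, him, by rw [hre]; simp, ?_⟩
  rw [him, show (4 : ℝ) * 1 * Δ ^ 2 - 0 ^ 2 = (2 * Δ) ^ 2 by ring, Real.sqrt_sq (by linarith),
    div_eq_div_iff (by positivity) hΔ.ne']
  ring

/-- **The Bessel series is positive**: `0 < Σ_{m,k ≥ 1} I(πymk)` for `y > 0`
(`I(κ) = ∫₀^∞ t⁻¹e^{−κ(t+1/t)}dt > 0`, summable by `I(κ) ≤ √(π/κ)e^{−2κ}`). [folklore] -/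
theorem tsum_besselIntegral_pos {y : ℝ} (hy : 0 < y) :
    0 < ∑' p : ℕ × ℕ, ∫ t in Ioi (0 : ℝ),
      t⁻¹ * Real.exp (-(Real.pi * y * ((p.1 : ℝ) + 1) * ((p.2 : ℝ) + 1)) * (t + t⁻¹)) := by
  have hsum : Summable fun p : ℕ × ℕ => 4 * Real.sqrt y * ∫ t in Ioi (0 : ℝ),
      t⁻¹ * Real.exp (-(Real.pi * y * ((p.1 : ℝ) + 1) * ((p.2 : ℝ) + 1)) * (t + t⁻¹)) := by
    refine (summable_cross_norms hy 0).congr fun p => ?_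
    simp only [mul_zero, zero_mul, Real.cos_zero, abs_one, mul_one]
  have hsy : Real.sqrt y ≠ 0 := (Real.sqrt_pos.2 hy).ne'
  have hu : Summable fun p : ℕ × ℕ => ∫ t in Ioi (0 : ℝ),
      t⁻¹ * Real.exp (-(Real.pi * y * ((p.1 : ℝ) + 1) * ((p.2 : ℝ) + 1)) * (t + t⁻¹)) := by
    refine (hsum.mul_left (1 / (4 * Real.sqrt y))).congr fun p => ?_
    field_simp
  have hpos : ∀ p : ℕ × ℕ, 0 < ∫ t in Ioi (0 : ℝ),
      t⁻¹ * Real.exp (-(Real.pi * y * ((p.1 : ℝ) + 1) * ((p.2 : ℝ) + 1)) * (t + t⁻¹)) := fun p =>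
    BesselK0.integral_inv_mul_exp_pos
      (κ := Real.pi * y * ((p.1 : ℝ) + 1) * ((p.2 : ℝ) + 1)) (by positivity)
  exact hu.tsum_pos (fun p => (hpos p).le) (0, 0) (hpos (0, 0))

/-- **The central value of `ζ^{(2)}(·, Δ)`, exactly** (Chowla–Selberg / Bateman–Grosswald at `½`).
For `Δ > 0` and the analytic continuation `F = ζ^{(2)}(·, Δ)`: `ζ^{(2)}(½, Δ)` is real and

  `ζ^{(2)}(½, Δ) = (γ − log Δ − log 4π + 2 Σ_{m,k ≥ 1} I(πmk/Δ)) / Δ`,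
  `I(κ) = ∫₀^∞ t⁻¹e^{−κ(t+1/t)}dt` (`= 2K₀(2κ)`),

i.e. Bateman–Grosswald's `a^{½}Z(½) = γ + log k − log 4π + 4Σ_n σ₀(n)K₀(2πkn)` (their (1)
`Z(s) = ½Σ'(am² + bmn + cn²)^{−s}` IS (1.1) for `Q = Δ²x² + y²`: `a = Δ²`, `k = √|d|/(2a) = 1/Δ`,
`a^{½}Z(½) = Δ·ζ^{(2)}(½, Δ)`). From the tree: `2F(½) = Δ^{−½}·Λ_{i/Δ}(½)`
(`continuation_ofReal_eq`) and `Λ_{iy}(½) = 2√y(γ + log y − log 4π) + 4√y Σ I(πymk)`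
(`re_Λ_half_eq_of_re_zero`). [cite: BatemanGrosswald1964, Theorem 1 (3)–(4) at s = 1/2] -/
theorem re_half_eq {Δ : ℝ} (hΔ : 0 < Δ) {F : ℂ → ℂ} (hF : IsZetaTwo Δ F) :
    (F (1 / 2)).re = (Real.eulerMascheroniConstant - Real.log Δ - Real.log (4 * Real.pi) +
        2 * ∑' p : ℕ × ℕ, ∫ t in Ioi (0 : ℝ), t⁻¹ *
          Real.exp (-(Real.pi * (1 / Δ) * ((p.1 : ℝ) + 1) * ((p.2 : ℝ) + 1)) * (t + t⁻¹))) / Δ ∧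
      (F (1 / 2)).im = 0 := by
  obtain ⟨z, hre, him, hre0, himΔ⟩ := exists_z hΔ
  have hZ := (isZetaTwo_iff Δ F).1 hF
  have e := continuation_ofReal_eq (posDef hΔ) z hre him hZ (σ := 1 / 2) (by norm_num) (by norm_num)
  have hhalf : ((1 / 2 : ℝ) : ℂ) = 1 / 2 := by push_cast; rfl
  -- the factor `c(½) = π^{1/2} Δ^{−1/2} / Γ(½) = Δ^{−1/2}`
  have hc : Real.pi ^ (1 / 2 : ℝ) * (Real.sqrt (4 * 1 * Δ ^ 2 - 0 ^ 2) / 2) ^ (-(1 / 2 : ℝ)) /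
      Real.Gamma (1 / 2) = (Real.sqrt Δ)⁻¹ := by
    rw [show (4 : ℝ) * 1 * Δ ^ 2 - 0 ^ 2 = (2 * Δ) ^ 2 by ring, Real.sqrt_sq (by linarith),
      show 2 * Δ / 2 = Δ by ring, Real.Gamma_one_half_eq, Real.rpow_neg hΔ.le,
      ← Real.sqrt_eq_rpow, ← Real.sqrt_eq_rpow]
    have hπ : Real.sqrt Real.pi ≠ 0 := (Real.sqrt_pos.2 Real.pi_pos).ne'
    field_simp
  have hΛre := re_Λ_half_eq_of_re_zero z hre0
  have hΛim := im_Λ_ofReal z (1 / 2)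
  rw [hhalf, hc] at e
  rw [hhalf, himΔ] at hΛre
  rw [hhalf] at hΛim
  -- `F(½) = Δ^{−1/2}/2 · Λ_{i/Δ}(½)`
  have eF : F (1 / 2) = (((Real.sqrt Δ)⁻¹ / 2 : ℝ) : ℂ) * (thetaFEPair z).Λ (1 / 2) := by
    have h2 : (((Real.sqrt Δ)⁻¹ / 2 : ℝ) : ℂ) = (1 / 2 : ℂ) * (((Real.sqrt Δ)⁻¹ : ℝ) : ℂ) := by
      push_cast; ring
    rw [h2, mul_assoc, ← e]
    ring
  have h1 : Real.sqrt (1 / Δ) = (Real.sqrt Δ)⁻¹ := by rw [one_div, Real.sqrt_inv]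
  have h2 : Real.log (1 / Δ) = -Real.log Δ := by rw [one_div, Real.log_inv]
  have h3 : (Real.sqrt Δ)⁻¹ * (Real.sqrt Δ)⁻¹ = Δ⁻¹ := by
    rw [← mul_inv, Real.mul_self_sqrt hΔ.le]
  constructor
  · set S := ∑' p : ℕ × ℕ, ∫ t in Ioi (0 : ℝ), t⁻¹ *
      Real.exp (-(Real.pi * (1 / Δ) * ((p.1 : ℝ) + 1) * ((p.2 : ℝ) + 1)) * (t + t⁻¹)) with hS
    rw [eF, Complex.re_ofReal_mul, hΛre, h1, h2, div_eq_mul_inv _ Δ, ← h3]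
    ring
  · rw [eF, Complex.im_ofReal_mul, hΛim, mul_zero]

/-- `e^γ/(4π) > 0`. [folklore] -/
theorem deltaStar_pos : 0 < deltaStar := by unfold deltaStar; positivity

/-- `log(e^γ/(4π)) = γ − log 4π`. [folklore] -/
theorem log_deltaStar :
    Real.log deltaStar = Real.eulerMascheroniConstant - Real.log (4 * Real.pi) := by
  unfold deltaStar
  rw [Real.log_div (Real.exp_pos _).ne' (by positivity), Real.log_exp]

/-- **`7.0554 < 4πe^{−γ} = (e^γ/(4π))⁻¹ < 7.0556`**: the conjectured constant is Bateman and
Grosswald's threshold `k = 4πe^{−γ}` (the zero of the constant term of (9)), strictly inside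
their window between (11) and (10); from the tree's bounds `0.57721558 < γ < 0.57721571`,
`0.57723 < log 4π − log 7.0554`, `log 4π − log 7.0556 < 0.5772056`.
[cite: BatemanGrosswald1964, Theorem 3 (9)–(11)] -/
theorem window_one_div_deltaStar : (7.0554 : ℝ) < 1 / deltaStar ∧ 1 / deltaStar < 7.0556 := by
  have hlog : Real.log (1 / deltaStar) = Real.log (4 * Real.pi) - Real.eulerMascheroniConstant := by
    rw [one_div, Real.log_inv, log_deltaStar]
    ring
  have hpos : 0 < 1 / deltaStar := one_div_pos.2 deltaStar_pos
  constructor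
  · rw [← Real.log_lt_log_iff (by norm_num) hpos, hlog]
    linarith [Literature.Analysis.SpecialFunctions.Real.eulerMascheroniConstant_lt_d8,
      lt_log_four_pi_sub_log]
  · rw [← Real.log_lt_log_iff hpos (by norm_num), hlog]
    linarith [Literature.Analysis.SpecialFunctions.Real.eulerMascheroniConstant_gt_d8,
      log_four_pi_sub_log_lt]

/-- `1/7.0556 < e^γ/(4π) < 1/7.0554` (so in particular `e^γ/(4π) ∈ (0, 1)`). [folklore] -/
theorem deltaStar_window : 1 / (7.0556 : ℝ) < deltaStar ∧ deltaStar < 1 / 7.0554 := by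
  obtain ⟨h1, h2⟩ := window_one_div_deltaStar
  constructor
  · have h := one_div_lt_one_div_of_lt (one_div_pos.2 deltaStar_pos) h2
    rwa [one_div_one_div] at h
  · have h := one_div_lt_one_div_of_lt (by norm_num : (0 : ℝ) < 7.0554) h1
    rwa [one_div_one_div] at h

/-- `e^γ/(4π) ∈ (0, 1)`. [folklore] -/
theorem deltaStar_mem_Ioo : deltaStar ∈ Ioo (0 : ℝ) 1 :=
  ⟨deltaStar_pos, deltaStar_window.2.trans (by norm_num)⟩

/-- **`ζ^{(2)}(½, e^γ/(4π)) = 8πe^{−γ} · Σ_{m,k≥1} I(4π²e^{−γ}mk)`**: at the conjectured value the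
constant term `γ − log Δ − log 4π` of the central value vanishes exactly and only the Bessel series
remains (`re_half_eq`, `log Δ_c^* = γ − log 4π`). [folklore] -/
theorem re_half_deltaStar_eq {F : ℂ → ℂ} (hF : IsZetaTwo deltaStar F) :
    (F (1 / 2)).re = 2 * (∑' p : ℕ × ℕ, ∫ t in Ioi (0 : ℝ), t⁻¹ *
        Real.exp (-(Real.pi * (1 / deltaStar) * ((p.1 : ℝ) + 1) * ((p.2 : ℝ) + 1)) * (t + t⁻¹))) /
      deltaStar := by
  rw [(re_half_eq deltaStar_pos hF).1, log_deltaStar]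
  ring

/-- **`ζ^{(2)}(½, e^γ/(4π)) > 0`** (and it is real): the value of the analytic continuation of
`ζ^{(2)}(·, e^γ/(4π))` at `s = ½` has positive real part and zero imaginary part. [folklore] -/
theorem re_half_deltaStar_pos {F : ℂ → ℂ} (hF : IsZetaTwo deltaStar F) :
    0 < (F (1 / 2)).re ∧ (F (1 / 2)).im = 0 := by
  refine ⟨?_, (re_half_eq deltaStar_pos hF).2⟩
  rw [re_half_deltaStar_eq hF]
  exact div_pos (mul_pos two_pos (tsum_besselIntegral_pos (one_div_pos.2 deltaStar_pos)))
    deltaStar_pos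

/-- **`e^γ/(4π)` is NOT a solution of `ζ^{(2)}(1/2, Δ) = 0`.** [folklore] -/
theorem not_vanishesAtHalf_deltaStar : ¬ VanishesAtHalf deltaStar := fun h => by
  obtain ⟨F, hF⟩ := exists_isZetaTwo deltaStar_pos
  have hpos := (re_half_deltaStar_pos hF).1
  rw [h F hF, Complex.zero_re] at hpos
  exact lt_irrefl _ hpos

/-- `e^γ/(4π)` is not in the solution set. [folklore] -/
theorem deltaStar_not_mem_solutionSet : deltaStar ∉ solutionSet := fun h =>
  not_vanishesAtHalf_deltaStar h.2

/-- **Conjecture 1.1 of Bétermin–Šamaj–Travěnec is false.** The printed statement "The unique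
solution of `ζ^{(2)}(1/2, Δ) = 0` for `Δ ∈ (0, 1)` is `Δ = Δ_c^* = e^γ/(4π)`", i.e.
`solutionSet = {e^γ/(4π)}`, fails: `e^γ/(4π) ∈ (0, 1)` is not a zero of `Δ ↦ ζ^{(2)}(½, Δ)` at all
(`ζ^{(2)}(½, e^γ/(4π)) > 0`, `re_half_deltaStar_pos`). [folklore] -/
theorem statement11_false : solutionSet ≠ {deltaStar} := fun h =>
  deltaStar_not_mem_solutionSet (h ▸ mem_singleton deltaStar)

/-- **The edge zero exists and lies strictly to the right of `e^γ/(4π)`**: there is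
`Δ_c ∈ (e^γ/(4π), 1/7.0554) ⊂ (0, 1)` with `ζ^{(2)}(½, Δ_c) = 0`. Proof: along `Δ = 1/y` the central
value is `g(y)/(2√y·…)` with `g(y) = 2√y(γ + log y − log 4π) + 4√y Σ I(πymk)` continuous
(`continuousOn_centralValueRect`), `g(7.0554) < 0` (Bateman–Grosswald (11), `re_Λ_half_neg`) and
`g(4πe^{−γ}) = 4√y Σ I > 0`; intermediate value theorem on `[7.0554, 4πe^{−γ}]`. (So the solution
set of Conjecture 1.1 is non-empty near the conjectured value — by 60-digit numerics, not certified
here, `Δ_c − e^γ/(4π) ≈ 5.9·10⁻²¹` — but does not contain it.)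
[cite: BatemanGrosswald1964, Theorem 3 (11)] -/
theorem exists_true_zero : ∃ Δ ∈ solutionSet, deltaStar < Δ ∧ Δ < 1 / 7.0554 := by
  set y₁ : ℝ := 1 / deltaStar with hy₁
  have hy₁7 : (7.0554 : ℝ) < y₁ := window_one_div_deltaStar.1
  have hy₁0 : 0 < y₁ := by linarith
  set g : ℝ → ℝ := fun y =>
    2 * Real.sqrt y * (Real.eulerMascheroniConstant + Real.log y - Real.log (4 * Real.pi)) +
      4 * Real.sqrt y * ∑' p : ℕ × ℕ, ∫ t in Ioi (0 : ℝ),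
        t⁻¹ * Real.exp (-(Real.pi * y * ((p.1 : ℝ) + 1) * ((p.2 : ℝ) + 1)) * (t + t⁻¹)) with hg
  have hcont : ContinuousOn g (Icc 7.0554 y₁) :=
    (continuousOn_centralValueRect (by norm_num : (0 : ℝ) < 7.0554)).mono Icc_subset_Ici_self
  -- left endpoint: Bateman–Grosswald (11) at `k = 7.0554`
  set z₁ : ℍ := ⟨⟨0, 7.0554⟩, by show (0 : ℝ) < 7.0554; norm_num⟩ with hz₁
  have hz₁re : z₁.re = 0 := rfl
  have hz₁im : z₁.im = 7.0554 := rfl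
  have h1 : g 7.0554 < 0 := by
    have h := re_Λ_half_neg z₁ (by rw [hz₁im]; exact sqrt_three_div_two_le) (by rw [hz₁im])
    rw [re_Λ_half_eq_of_re_zero z₁ hz₁re, hz₁im] at h
    exact h
  -- right endpoint: the constant term vanishes and the Bessel series is positive
  have hlog : Real.log y₁ = Real.log (4 * Real.pi) - Real.eulerMascheroniConstant := by
    rw [hy₁, one_div, Real.log_inv, log_deltaStar]
    ring
  have h2 : 0 < g y₁ := by
    have hS := tsum_besselIntegral_pos hy₁0
    have hsq := Real.sqrt_pos.2 hy₁0
    have h0 : 2 * Real.sqrt y₁ *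
        (Real.eulerMascheroniConstant + Real.log y₁ - Real.log (4 * Real.pi)) = 0 := by
      rw [hlog]; ring
    show 0 < 2 * Real.sqrt y₁ *
        (Real.eulerMascheroniConstant + Real.log y₁ - Real.log (4 * Real.pi)) +
      4 * Real.sqrt y₁ * ∑' p : ℕ × ℕ, ∫ t in Ioi (0 : ℝ),
        t⁻¹ * Real.exp (-(Real.pi * y₁ * ((p.1 : ℝ) + 1) * ((p.2 : ℝ) + 1)) * (t + t⁻¹))
    rw [h0, zero_add]
    exact mul_pos (mul_pos (by norm_num) hsq) hS
  obtain ⟨y, hy, hgy⟩ := intermediate_value_Icc hy₁7.le hcont ⟨h1.le, h2.le⟩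
  have hya : (7.0554 : ℝ) < y := lt_of_le_of_ne hy.1 fun h => by
    rw [← h] at hgy; linarith
  have hyb : y < y₁ := lt_of_le_of_ne hy.2 fun h => by
    rw [h] at hgy; linarith
  have hy0 : 0 < y := by linarith
  refine ⟨1 / y, ?_, ?_, one_div_lt_one_div_of_lt (by norm_num) hya⟩
  swap
  · rw [show deltaStar = 1 / y₁ by rw [hy₁, one_div_one_div]]
    exact one_div_lt_one_div_of_lt hy0 hyb
  rw [solutionSet, mem_setOf_eq]
  refine ⟨⟨by positivity, ?_⟩, ?_⟩
  · rw [div_lt_one hy0]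
    linarith
  · intro F hF
    have hΔ : (0 : ℝ) < 1 / y := by positivity
    obtain ⟨z, hre, him, hre0, himy⟩ := exists_z hΔ
    rw [one_div_one_div] at himy
    have hΛ : (thetaFEPair z).Λ ((1 / 2 : ℝ) : ℂ) = 0 := by
      apply Complex.ext
      · rw [re_Λ_half_eq_of_re_zero z hre0, himy, Complex.zero_re]
        exact hgy
      · rw [im_Λ_ofReal, Complex.zero_im]
    have e := continuation_ofReal_eq (posDef hΔ) z hre him ((isZetaTwo_iff _ F).1 hF)
      (σ := 1 / 2) (by norm_num) (by norm_num)
    have hhalf : ((1 / 2 : ℝ) : ℂ) = 1 / 2 := by push_cast; rfl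
    rw [hΛ, mul_zero, hhalf] at e
    exact (mul_eq_zero.1 e).resolve_left two_ne_zero

end Literature.NumberTheory.LFunctions.BeterminSamajTravenec2021

end
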